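import Summits.QuantumFields.YangMills.Theorems.StaticSourceWitnessRungLatticeResponse
import Summits.QuantumFields.YangMills.Theorems.StaticSourceWitnessRungKernelCone

/-!
# Route `StaticSourceWitness`, crux X₁ `StaticSourceResponse` (stmt-QuantumFields-25284):
# lattice-Maxwell rung, file 5/5 — the dipole-energy hyperscaling floor and the UNCONDITIONAL
# X₁-shaped statement in lattice Maxwell theory

Banking file (`--supports stmt-QuantumFields-25284`), port of Part C (second half) of the crux
workfile `Cruxes/StaticSourceResponse/Lines/rung.lean` v3 (seat `ym-mirror-bc5w-1`, 2026-08-28;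
there `Rung.dipoleEnergyFloor` / `Rung.latticeMaxwell_staticSourceResponse`).

The hyperscaling configuration: lattice scales `N = ⌊ℓ/(64a)⌋ ≥ R₀`, `X = ⌊ℓ/(2a)⌋ ∈ [32N, 64N]`;
source rectangle `rectPlaq (xr X) P12 N N` (`N × N` plaquettes in the `(1,2)` plane at `−X e₀`,
strictly inside `{y₀ < 0}`); probe the bump `wfun ℓ` (`≡ 1` on the `(2N+1)⁴`-site box `box X N` around
`+X e₀`, support in `{y₀ ≥ ℓ/4} ∩ B̄(0, 3ℓ/4)`).  Every source–probe pair lies in the transverse cone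
with `N² ≤ |z|² ≤ 16650 N²` (`geom`), so the kernel is `≥ k_min = 1/(4π²(16650N²)²)`
(`kernel_lower_at`), the source field is `≥ N²·k_min` at each probe site (`dipoleField_lower`), and
the `a`-powers cancel exactly:

  `dipoleEnergy ≥ (2N+1)⁴ · (N² k_min)² ≥ 1/(16 π⁴ 16650⁴) =: c₁`  for all `a ≤ a₀ := ℓ/(128 R₀)`, `L ≥ ℓ/a`

(`dipoleEnergyFloor`).  With file 3/5 (`latticeMaxwell_X1_of_floor`) this gives the X₁-shaped
static-source response statement of the abelian lattice gauge theory `curvatureGaussianField 4 1`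
at fixed coupling, UNCONDITIONALLY (`latticeMaxwell_staticSourceResponse`): for every window `ℓ` a
probe `v` (Schwartz, `supp v ⊆ {y₀ > 0} ∩ B̄(0, ℓ)`, `v ≠ 0`) and `c₁, a₀ > 0` uniform in the
spacing `a ≤ a₀` and the volume `L`, a mirror rectangle strictly inside `{y₀ < 0}` within distance
`ℓ`, with `0 < E[w] ∧ c₁·E[w] ≤ |Cov(w, Ṽ_v)|`.

This is the BC5 / T3 witness of weakness for X₁ (C's analogue TRUE in a model where S's clause (ii)
analogue is FALSE, tree `maxwellRing3_eq_zero`).  NOTHING here proves the Yang–Mills mass gap,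
`BalabanLadder.NT`, or X₁ itself.
-/

set_option autoImplicit false

open MeasureTheory
open scoped Real

noncomputable section

namespace Summit.QuantumFields.YangMills.Theorems.StaticSourceWitness.Rung

section Floor

open Literature.Probability.LatticeModels Literature.MathematicalPhysics.QuantumLattice
  Literature.MathematicalPhysics.QuantumFieldTheory
open Metric Set

/-! ## the source: base point, plaquette coordinates, the sum over the rectangle -/

/-- Time coordinate of a source plaquette site: `−X`. [folklore] -/
theorem px_apply_0 (X m n : ℕ) : px X m n 0 = -(X : ℤ) := by simp [px, xr]

/-- First spatial coordinate of a source plaquette site: `m`. [folklore] -/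
theorem px_apply_1 (X m n : ℕ) : px X m n 1 = m := by simp [px, xr]

/-- Second spatial coordinate of a source plaquette site: `n`. [folklore] -/
theorem px_apply_2 (X m n : ℕ) : px X m n 2 = n := by simp [px, xr]

/-- Third spatial coordinate of a source plaquette site: `0`. [folklore] -/
theorem px_apply_3 (X m n : ℕ) : px X m n 3 = 0 := by simp [px, xr]

/-- The source rectangle as the image of the `R × T` grid under `px`. [folklore] -/
theorem rectPlaq_eq (X R T : ℕ) : rectPlaq (xr X) P12 R T =
    (Finset.range R ×ˢ Finset.range T).image fun mn => (px X mn.1 mn.2, P12) := by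
  simp [rectPlaq, px, P12]

/-- `px X` is injective on grid coordinates. [folklore] -/
theorem px_inj (X : ℕ) {mn mn' : ℕ × ℕ}
    (h : (px X mn.1 mn.2, P12) = (px X mn'.1 mn'.2, P12)) : mn = mn' := by
  have h1 := congr_arg (fun q : ZdPlaquette 4 => q.1 1) h
  have h2 := congr_arg (fun q : ZdPlaquette 4 => q.1 2) h
  simp only [px_apply_1, px_apply_2, Nat.cast_inj] at h1 h2
  exact Prod.ext h1 h2

/-- The source's field at `q` as a sum over the `R × T` grid. [folklore] -/
theorem dipoleField_rect (X R T : ℕ) (q : ZdPlaquette 4) :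
    dipoleField (rectPlaq (xr X) P12 R T) q =
      ∑ mn ∈ Finset.range R ×ˢ Finset.range T, curvatureTwoPoint (px X mn.1 mn.2, P12) q := by
  rw [dipoleField, rectPlaq_eq, Finset.sum_image]
  intro mn _ mn' _ h
  exact px_inj X h

/-! ## the probe box -/

/-- Membership in the probe box, coordinatewise. [folklore] -/
theorem mem_box {X N : ℕ} {y : Site 4} :
    y ∈ box X N ↔ ∀ k, cy X k - N ≤ y k ∧ y k ≤ cy X k + N := by
  simp [box, Fintype.mem_piFinset, Finset.mem_Icc]

/-- The probe box has `(2N+1)⁴` sites. [folklore] -/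
theorem card_box (X N : ℕ) : (box X N).card = (2 * N + 1) ^ 4 := by
  rw [box, Fintype.card_piFinset]
  simp only [Int.card_Icc]
  have : ∀ k : Fin 4, (cy X k + ↑N + 1 - (cy X k - ↑N)).toNat = 2 * N + 1 := by
    intro k
    have : cy X k + ↑N + 1 - (cy X k - ↑N) = ((2 * N + 1 : ℕ) : ℤ) := by push_cast; ring
    rw [this, Int.toNat_natCast]
  simp only [this, Finset.prod_const, Finset.card_univ, Fintype.card_fin]

/-- Time coordinate of the box centre: `X`. [folklore] -/
theorem cy_apply_0 (X : ℕ) : cy X 0 = (X : ℤ) := by simp [cy]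

/-- Spatial coordinates of the box centre: `0`. [folklore] -/
theorem cy_apply_ne (X : ℕ) {k : Fin 4} (hk : k ≠ 0) : cy X k = 0 := by simp [cy, hk]

/-- Real-coordinate bounds of a probe-box site. [folklore] -/
theorem box_bounds {X N : ℕ} {y : Site 4} (hy : y ∈ box X N) :
    |((y 0 : ℤ) : ℝ) - X| ≤ N ∧ |((y 1 : ℤ) : ℝ)| ≤ N ∧ |((y 2 : ℤ) : ℝ)| ≤ N ∧
      |((y 3 : ℤ) : ℝ)| ≤ N := by
  rw [mem_box] at hy
  have h0 := hy 0; have h1 := hy 1; have h2 := hy 2; have h3 := hy 3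
  rw [cy_apply_0] at h0
  rw [cy_apply_ne X (by decide)] at h1 h2 h3
  refine ⟨?_, ?_, ?_, ?_⟩ <;> rw [abs_le] <;> constructor
  · have : ((X : ℤ) : ℝ) - N ≤ ((y 0 : ℤ) : ℝ) := by exact_mod_cast h0.1
    push_cast at this; linarith
  · have : ((y 0 : ℤ) : ℝ) ≤ ((X : ℤ) : ℝ) + N := by exact_mod_cast h0.2
    push_cast at this; linarith
  · have : ((0 : ℤ) : ℝ) - N ≤ ((y 1 : ℤ) : ℝ) := by exact_mod_cast h1.1
    push_cast at this; linarith
  · have : ((y 1 : ℤ) : ℝ) ≤ ((0 : ℤ) : ℝ) + N := by exact_mod_cast h1.2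
    push_cast at this; linarith
  · have : ((0 : ℤ) : ℝ) - N ≤ ((y 2 : ℤ) : ℝ) := by exact_mod_cast h2.1
    push_cast at this; linarith
  · have : ((y 2 : ℤ) : ℝ) ≤ ((0 : ℤ) : ℝ) + N := by exact_mod_cast h2.2
    push_cast at this; linarith
  · have : ((0 : ℤ) : ℝ) - N ≤ ((y 3 : ℤ) : ℝ) := by exact_mod_cast h3.1
    push_cast at this; linarith
  · have : ((y 3 : ℤ) : ℝ) ≤ ((0 : ℤ) : ℝ) + N := by exact_mod_cast h3.2
    push_cast at this; linarith

/-- `|z|²` of the separation between the `(m, n)` plaquette of the source and the probe site `y`.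
[folklore] -/
theorem S_px_sub (X m n : ℕ) (y : Site 4) :
    S (px X m n - y) = (-(X : ℝ) - ((y 0 : ℤ) : ℝ)) ^ 2 + ((m : ℝ) - ((y 1 : ℤ) : ℝ)) ^ 2 +
      ((n : ℝ) - ((y 2 : ℤ) : ℝ)) ^ 2 + (-((y 3 : ℤ) : ℝ)) ^ 2 := by
  rw [S_eq]
  simp only [Pi.sub_apply, px_apply_0, px_apply_1, px_apply_2, px_apply_3]
  push_cast
  ring

/-- The uniform kernel floor `k_min = 1/(4π²(16650N²)²)` between every source plaquette and every
probe site of the hyperscaling configuration. -/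
theorem kernel_lower_at {R₀ : ℝ}
    (hker : ∀ x y : Site 4,
      4 * ((((x - y) 1 : ℤ) : ℝ) ^ 2 + (((x - y) 2 : ℤ) : ℝ) ^ 2) ≤ S (x - y) → R₀ ^ 2 ≤ S (x - y) →
        1 / (4 * π ^ 2 * S (x - y) ^ 2) ≤ curvatureTwoPoint (x, P12) (y, P12))
    {X N m n : ℕ} {y : Site 4} (hR0 : 0 ≤ R₀) (hN : (1 : ℝ) ≤ N) (hR : R₀ ≤ N)
    (hX1 : 32 * (N : ℝ) ≤ X) (hX2 : (X : ℝ) ≤ 64 * N) (hm : m < N) (hn : n < N)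
    (hy : y ∈ box X N) :
    1 / (4 * π ^ 2 * (16650 * (N : ℝ) ^ 2) ^ 2) ≤ curvatureTwoPoint (px X m n, P12) (y, P12) := by
  obtain ⟨b0, b1, b2, b3⟩ := box_bounds hy
  have hm' : (m : ℝ) ≤ N := by exact_mod_cast hm.le
  have hn' : (n : ℝ) ≤ N := by exact_mod_cast hn.le
  obtain ⟨gcone, gfar, gnear⟩ :=
    geom hN hX1 hX2 (Nat.cast_nonneg m) hm' (Nat.cast_nonneg n) hn' b0 b1 b2 b3
  have hS := S_px_sub X m n y
  have hz1 : (((px X m n - y) 1 : ℤ) : ℝ) = (m : ℝ) - ((y 1 : ℤ) : ℝ) := by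
    simp only [Pi.sub_apply, px_apply_1]; push_cast; ring
  have hz2 : (((px X m n - y) 2 : ℤ) : ℝ) = (n : ℝ) - ((y 2 : ℤ) : ℝ) := by
    simp only [Pi.sub_apply, px_apply_2]; push_cast; ring
  have h := hker (px X m n) y (by rw [hz1, hz2, hS]; exact gcone)
    (by rw [hS]; exact le_trans (by nlinarith [sq_nonneg (N - R₀)]) gfar)
  refine le_trans ?_ h
  have hSpos : 0 < S (px X m n - y) := by rw [hS]; nlinarith
  apply one_div_le_one_div_of_le (by positivity)
  have : S (px X m n - y) ≤ 16650 * (N : ℝ) ^ 2 := by rw [hS]; exact gnear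
  have h2 : S (px X m n - y) ^ 2 ≤ (16650 * (N : ℝ) ^ 2) ^ 2 := pow_le_pow_left₀ hSpos.le this 2
  nlinarith [Real.pi_pos, sq_nonneg π]

/-- The source's field at every probe site: `N²` plaquettes, each contributing `≥ k_min`. -/
theorem dipoleField_lower {R₀ : ℝ}
    (hker : ∀ x y : Site 4,
      4 * ((((x - y) 1 : ℤ) : ℝ) ^ 2 + (((x - y) 2 : ℤ) : ℝ) ^ 2) ≤ S (x - y) → R₀ ^ 2 ≤ S (x - y) →
        1 / (4 * π ^ 2 * S (x - y) ^ 2) ≤ curvatureTwoPoint (x, P12) (y, P12))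
    {X N : ℕ} {y : Site 4} (hR0 : 0 ≤ R₀) (hN : (1 : ℝ) ≤ N) (hR : R₀ ≤ N) (hX1 : 32 * (N : ℝ) ≤ X)
    (hX2 : (X : ℝ) ≤ 64 * N) (hy : y ∈ box X N) :
    (N : ℝ) ^ 2 * (1 / (4 * π ^ 2 * (16650 * (N : ℝ) ^ 2) ^ 2)) ≤
      dipoleField (rectPlaq (xr X) P12 N N) (y, P12) := by
  rw [dipoleField_rect]
  have h := Finset.card_nsmul_le_sum (Finset.range N ×ˢ Finset.range N)
    (fun mn : ℕ × ℕ => curvatureTwoPoint (px X mn.1 mn.2, P12) (y, P12))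
    (1 / (4 * π ^ 2 * (16650 * (N : ℝ) ^ 2) ^ 2)) (by
      intro mn hmn
      rw [Finset.mem_product, Finset.mem_range, Finset.mem_range] at hmn
      exact kernel_lower_at hker hR0 hN hR hX1 hX2 hmn.1 hmn.2 hy)
  rw [Finset.card_product, Finset.card_range, nsmul_eq_mul] at h
  push_cast at h
  simpa [sq] using h

/-- The probe box lies in the volume cube once `X + N ≤ L`. [folklore] -/
theorem box_subset_cube {X N L : ℕ} (h : X + N ≤ L) : box X N ⊆ cube L := by
  intro y hy
  rw [mem_box] at hy
  simp only [cube, Fintype.mem_piFinset, Finset.mem_Icc]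
  intro k
  have hk := hy k
  by_cases hk0 : k = 0
  · subst hk0; rw [cy_apply_0] at hk; omega
  · rw [cy_apply_ne X hk0] at hk; omega

/-- The `(1,2)` plaquette at `y` belongs to the plaquette star of `y`. [folklore] -/
theorem mem_plaqAt (y : Site 4) : (y, P12) ∈ plaqAt y :=
  Finset.mem_image.mpr ⟨P12, Finset.mem_univ _, rfl⟩

/-- The probe is `≡ 1` on the probe box once `aN ≤ ℓ/64` and `|aX − ℓ/2| ≤ ℓ/128`. -/
theorem probe_one {ℓ : ℝ} (hℓ : 0 < ℓ) {a : ℝ} (ha : 0 ≤ a) {X N : ℕ} {y : Site 4} (hy : y ∈ box X N)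
    (haX : |a * X - ℓ / 2| ≤ ℓ / 128) (haN : a * N ≤ ℓ / 64) : wfun ℓ hℓ (a • siteToE y) = 1 := by
  obtain ⟨b0, b1, b2, b3⟩ := box_bounds hy
  apply wfun_eq_one_of_coord hℓ
  · simp only [PiLp.smul_apply, siteToE_apply, smul_eq_mul]
    have e : a * ((y 0 : ℤ) : ℝ) - ℓ / 2 = a * (((y 0 : ℤ) : ℝ) - X) + (a * X - ℓ / 2) := by ring
    rw [e]
    calc |a * (((y 0 : ℤ) : ℝ) - X) + (a * X - ℓ / 2)|
        ≤ |a * (((y 0 : ℤ) : ℝ) - X)| + |a * X - ℓ / 2| := abs_add_le _ _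
      _ ≤ a * N + ℓ / 128 := by
          refine add_le_add ?_ haX
          rw [abs_mul, abs_of_nonneg ha]
          exact mul_le_mul_of_nonneg_left b0 ha
      _ ≤ ℓ / 16 := by linarith
  · intro k hk
    simp only [PiLp.smul_apply, siteToE_apply, smul_eq_mul]
    rw [abs_mul, abs_of_nonneg ha]
    have hb : |((y k : ℤ) : ℝ)| ≤ N := by
      fin_cases k
      · exact absurd rfl hk
      · exact b1
      · exact b2
      · exact b3
    calc a * |((y k : ℤ) : ℝ)| ≤ a * N := mul_le_mul_of_nonneg_left hb ha
      _ ≤ ℓ / 16 := by linarith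

/-- **The dipole-energy hyperscaling floor** (the workfile's `Rung.DipoleEnergyFloor`, formerly the
plan-only stub `stub_rung_dipoleEnergyFloor`): for every window `ℓ > 0` a nonnegative Schwartz probe
`v` with `supp v ⊆ {y₀ > 0} ∩ B̄(0, ℓ)`, `v ≠ 0`, and constants `c₁, a₀ > 0` such that for all
spacings `0 < a ≤ a₀` and volumes `L` with `ℓ ≤ aL` some mirror rectangle strictly inside `{y₀ < 0}`
within physical distance `ℓ` has probe-weighted classical field energy `≥ c₁`
(`c₁ = 1/(16π⁴·16650⁴)`, `a₀ = ℓ/(128R₀)`). -/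
theorem dipoleEnergyFloor : ∀ ℓ : ℝ, 0 < ℓ →
    ∃ (v : SchwartzMap (EuclideanSpace ℝ (Fin 4)) ℝ) (c₁ a₀ : ℝ),
    tsupport (v : EuclideanSpace ℝ (Fin 4) → ℝ) ⊆ {y | 0 < y 0} ∧
    tsupport (v : EuclideanSpace ℝ (Fin 4) → ℝ) ⊆ Metric.closedBall 0 ℓ ∧
    (v : EuclideanSpace ℝ (Fin 4) → ℝ) ≠ 0 ∧ (∀ z, 0 ≤ v z) ∧ 0 < c₁ ∧ 0 < a₀ ∧
    ∀ a : ℝ, 0 < a → a ≤ a₀ → ∀ L : ℕ, ℓ ≤ a * L →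
      ∃ (x : Site 4) (ij : Plane) (R T : ℕ), 1 ≤ R ∧ 1 ≤ T ∧
        ((x 0 : ℤ) + R + T ≤ -1) ∧ (-ℓ ≤ a * (x 0 : ℝ)) ∧ (∀ k, |(x k : ℝ)| * a ≤ ℓ) ∧
        c₁ ≤ dipoleEnergy a (v : EuclideanSpace ℝ (Fin 4) → ℝ) (rectPlaq x ij R T) L := by
  intro ℓ hℓ
  obtain ⟨R₀, hR₀1, hker⟩ := kernel_cone_lower
  have hR₀0 : 0 ≤ R₀ := by linarith
  refine ⟨wfun ℓ hℓ, 1 / (16 * π ^ 4 * 16650 ^ 4), ℓ / (128 * R₀), wfun_tsupport_pos hℓ,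
    wfun_tsupport_ball hℓ, wfun_ne_zero hℓ, wfun_nonneg hℓ, by positivity, by positivity, ?_⟩
  intro a ha ha₀ L hL
  -- the two lattice scales `N = ⌊ℓ/(64a)⌋`, `X = ⌊ℓ/(2a)⌋`
  set t : ℝ := ℓ / (64 * a) with ht
  have hat : a * t = ℓ / 64 := by rw [ht]; field_simp
  have ht2 : 2 * R₀ ≤ t := by
    rw [ht, le_div_iff₀ (by positivity)]
    have : a * (128 * R₀) ≤ ℓ := by rwa [le_div_iff₀ (by positivity)] at ha₀
    linarith
  set N : ℕ := ⌊t⌋₊ with hN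
  have htN : (N : ℝ) ≤ t := Nat.floor_le (by positivity)
  have htN' : t < N + 1 := Nat.lt_floor_add_one t
  have hN1 : (1 : ℝ) ≤ N := by linarith
  have hRN : R₀ ≤ N := by linarith
  have hNnat : 1 ≤ N := by exact_mod_cast hN1
  set X : ℕ := ⌊ℓ / (2 * a)⌋₊ with hX
  have hX32t : ℓ / (2 * a) = 32 * t := by rw [ht]; field_simp; ring
  have hXle : (X : ℝ) ≤ 32 * t := by rw [← hX32t]; exact Nat.floor_le (by positivity)
  have hXgt : 32 * t < X + 1 := by rw [← hX32t]; exact Nat.lt_floor_add_one _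
  have hX1nat : 32 * N ≤ X := by
    have h : ((32 * N : ℕ) : ℝ) < X + 1 := by push_cast; linarith
    have h' : 32 * N < X + 1 := by exact_mod_cast h
    omega
  have hX1 : 32 * (N : ℝ) ≤ X := by exact_mod_cast hX1nat
  have hX2 : (X : ℝ) ≤ 64 * N := by linarith
  have haN : a * N ≤ ℓ / 64 := by rw [← hat]; exact mul_le_mul_of_nonneg_left htN ha.le
  have haX : a * X ≤ ℓ / 2 := by
    have : a * X ≤ a * (32 * t) := mul_le_mul_of_nonneg_left hXle ha.le
    linarith [show a * (32 * t) = ℓ / 2 by rw [show a * (32 * t) = 32 * (a * t) by ring, hat]; ring]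
  have haX' : ℓ / 2 - a < a * X := by
    have : a * (32 * t) < a * (X + 1) := mul_lt_mul_of_pos_left hXgt ha
    have e : a * (32 * t) = ℓ / 2 := by rw [show a * (32 * t) = 32 * (a * t) by ring, hat]; ring
    linarith
  have ha128 : a ≤ ℓ / 128 := by
    have : a * (128 * R₀) ≤ ℓ := by rwa [le_div_iff₀ (by positivity)] at ha₀
    rw [le_div_iff₀ (by norm_num)]
    nlinarith
  have habsX : |a * X - ℓ / 2| ≤ ℓ / 128 := by
    rw [abs_le]; constructor <;> linarith
  have hxr0 : xr X 0 = -(X : ℤ) := by simp [xr]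
  have hxr0R : ((xr X 0 : ℤ) : ℝ) = -(X : ℝ) := by rw [hxr0]; push_cast; ring
  refine ⟨xr X, P12, N, N, hNnat, hNnat, ?_, ?_, ?_, ?_⟩
  · rw [hxr0]
    have h1 : (32 * N : ℤ) ≤ X := by exact_mod_cast hX1nat
    have h2 : (1 : ℤ) ≤ N := by exact_mod_cast hNnat
    linarith
  · rw [hxr0R]
    linarith
  · intro k
    by_cases hk : k = 0
    · subst hk
      rw [hxr0R, abs_neg, Nat.abs_cast]
      linarith
    · have : xr X k = 0 := by simp [xr, hk]
      rw [this]
      push_cast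
      rw [abs_zero, zero_mul]
      exact hℓ.le
  · -- the floor
    have hsub : box X N ⊆ cube L := by
      apply box_subset_cube
      have h1 : ((X : ℝ) + N) ≤ L := by
        have hLa : ℓ / a ≤ L := by rw [div_le_iff₀ ha]; linarith
        have : (X : ℝ) + N ≤ 33 * t := by linarith
        have e : ℓ / a = 64 * t := by rw [ht]; field_simp
        have : 33 * t ≤ 64 * t := by nlinarith
        linarith
      exact_mod_cast h1
    set kmin : ℝ := 1 / (4 * π ^ 2 * (16650 * (N : ℝ) ^ 2) ^ 2) with hkmin
    have hkmin0 : 0 ≤ (N : ℝ) ^ 2 * kmin := by positivity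
    have hterm : ∀ y ∈ box X N, ((N : ℝ) ^ 2 * kmin) ^ 2 ≤
        wfun ℓ hℓ (a • siteToE y) * ∑ q ∈ plaqAt y, dipoleField (rectPlaq (xr X) P12 N N) q ^ 2 := by
      intro y hy
      rw [probe_one hℓ ha.le hy habsX haN, one_mul]
      refine le_trans ?_ (Finset.single_le_sum (fun q _ => sq_nonneg _) (mem_plaqAt y))
      exact pow_le_pow_left₀ hkmin0 (dipoleField_lower hker hR₀0 hN1 hRN hX1 hX2 hy) 2
    have hN0 : (0 : ℝ) < N := by linarith
    calc 1 / (16 * π ^ 4 * 16650 ^ 4) = (N : ℝ) ^ 4 * ((N : ℝ) ^ 2 * kmin) ^ 2 := by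
          rw [hkmin]; field_simp; ring
      _ ≤ ((box X N).card : ℝ) * ((N : ℝ) ^ 2 * kmin) ^ 2 := by
          rw [card_box]; push_cast
          apply mul_le_mul_of_nonneg_right _ (sq_nonneg _)
          have : (N : ℝ) ≤ 2 * N + 1 := by linarith
          exact pow_le_pow_left₀ hN0.le this 4
      _ = (box X N).card • ((N : ℝ) ^ 2 * kmin) ^ 2 := by rw [nsmul_eq_mul]
      _ ≤ ∑ y ∈ box X N, wfun ℓ hℓ (a • siteToE y) *
            ∑ q ∈ plaqAt y, dipoleField (rectPlaq (xr X) P12 N N) q ^ 2 :=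
          Finset.card_nsmul_le_sum _ _ _ hterm
      _ ≤ dipoleEnergy a (wfun ℓ hℓ) (rectPlaq (xr X) P12 N N) L := by
          apply Finset.sum_le_sum_of_subset_of_nonneg hsub
          intro y _ _
          exact mul_nonneg (wfun_nonneg hℓ _) (Finset.sum_nonneg fun _ _ => sq_nonneg _)

/-- **The lattice-Maxwell rung of X₁, UNCONDITIONAL**: the X₁-shaped static-source response
statement — a probe per window `ℓ`, `c₁, a₀ > 0` uniform in the spacing `a ≤ a₀` and the volume `L`,
a mirror rectangle strictly inside `{y₀ < 0}` within distance `ℓ`, and the witness clause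
`0 < E[w] ∧ c₁·E[w] ≤ |Cov(w, Ṽ_v)|` — in the abelian lattice gauge theory `curvatureGaussianField 4 1`
at fixed (Gaussian) coupling.  (BC5 / T3 witness for `StaticSourceResponse`, stmt-QuantumFields-25284;
not a proof of X₁, of `BalabanLadder.NT`, or of the mass gap.) -/
theorem latticeMaxwell_staticSourceResponse :
    ∀ ℓ : ℝ, 0 < ℓ → ∃ (v : SchwartzMap (EuclideanSpace ℝ (Fin 4)) ℝ) (c₁ a₀ : ℝ),
      tsupport (v : EuclideanSpace ℝ (Fin 4) → ℝ) ⊆ {y | 0 < y 0} ∧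
      tsupport (v : EuclideanSpace ℝ (Fin 4) → ℝ) ⊆ Metric.closedBall 0 ℓ ∧
      (v : EuclideanSpace ℝ (Fin 4) → ℝ) ≠ 0 ∧ 0 < c₁ ∧ 0 < a₀ ∧
      ∀ a : ℝ, 0 < a → a ≤ a₀ → ∀ L : ℕ, ℓ ≤ a * L →
        ∃ (x : Site 4) (ij : Plane) (R T : ℕ), 1 ≤ R ∧ 1 ≤ T ∧
          ((x 0 : ℤ) + R + T ≤ -1) ∧ (-ℓ ≤ a * (x 0 : ℝ)) ∧ (∀ k, |(x k : ℝ)| * a ≤ ℓ) ∧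
          0 < ∫ ω, wLoop (rectPlaq x ij R T) ω ∂μM ∧
          c₁ * ∫ ω, wLoop (rectPlaq x ij R T) ω ∂μM ≤
            |(∫ ω, wLoop (rectPlaq x ij R T) ω *
                  probe a (v : EuclideanSpace ℝ (Fin 4) → ℝ) L ω ∂μM)
              - (∫ ω, wLoop (rectPlaq x ij R T) ω ∂μM) *
                  (∫ ω, probe a (v : EuclideanSpace ℝ (Fin 4) → ℝ) L ω ∂μM)| := by
  intro ℓ hℓ
  obtain ⟨v, c₁, a₀, h1, h2, h3, _h4, h5, h6, h7⟩ := dipoleEnergyFloor ℓ hℓ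
  refine ⟨v, c₁, a₀, h1, h2, h3, h5, h6, fun a ha ha₀ L hL => ?_⟩
  obtain ⟨x, ij, R, T, hR, hT, g1, g2, g3, hfl⟩ := h7 a ha ha₀ L hL
  exact ⟨x, ij, R, T, hR, hT, g1, g2, g3, latticeMaxwell_X1_of_floor hfl⟩

end Floor

end Summit.QuantumFields.YangMills.Theorems.StaticSourceWitness.Rung

end
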